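/-
Copyright (c) 2026 the pub-hodgecm-mathlib formalisation cell (harness21).  Prover seat hodgecm-mathlib-F0P3-p02 (g26), 2026-09-03.  E1 row 47c R-c «JACQUET FUNCTOR OF THE
SCHNEIDER–STUHLER RESOLUTION», FILE 3 «THE JACQUET MODULE OF A BLOCK-PERMUTATION MODULE: `r(τ) − 1` IS INJECTIVE; THE DIMENSION OF ITS COKERNEL» (census row 47 §2 (A3); plan
02:20:35Z; over ★ `JacquetModule`, ★ 47c FILE 1 p853299, FILE 2a p853330, FILE 2b).
-/
import Literature.NumberTheory.Automorphic.JacquetModule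
import Literature.RepresentationTheory.CoinvariantsBlockPermutationGrading
import Literature.LinearAlgebra.ShiftMinusIdentity
import HarnessLib

/-!
# The Jacquet module of a block-permutation module: `r(τ) − 1` is injective and `dim coker (r(τ) − 1) = Σ_{ht r = 0} dim W_r ⧸ K_r`

Topic `NumberTheory/Automorphic`; declarations in the `Representation` namespace (deliberate dot-style extension, lean/CONVENTIONS.md §2).  THEOREMS ONLY (no definition, no instance, no
notation, no named fact, no `sorry`).  Cell `pub/hodgecm-mathlib` (D-0151), crux H413 = `stmt-HodgeConjecture-24833`, lane `--supports`; E1 BRICK LEDGER row 47c FILE 3.  HONEST LABEL: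
count-neutral generic base layer; (R-SS) NOT chartered; E1 = PRINT until the keeper's charter test; HC_CM is proved only modulo the 2 remaining named inputs (hLiu418 =
`stmt-HodgeConjecture-24832`, h413 = `stmt-HodgeConjecture-24833`) until rung 0 closes.

THE MATHEMATICS ([BernsteinZelevinsky1976, §2.3]; [Casselman1995, §3.1–§3.2, §6.3]; [Brown1982, III §5–§6]).  `t = (P, M, N)` a parabolic triple (★ `ParabolicTriple`) in a group `G`
(model: `G = B` a minimal parabolic of a rank-one `p`-adic group, `t = (B, T, N)`), `ρ` a representation of `G` on `M = ⊕_{b ∈ β} W_b` PERMUTING THE BLOCKS along an action `act` of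
`G` on the labels (`ρ(g) W_b ⊆ W_{g·b}`), with `N`-ORBIT DATA (`rep b` the representative of the `N`-orbit of `b`, `tr b ∈ N` a transporter, `tr b · rep b = b`, representatives
`R`), a HEIGHT `ht` on representatives and a torus element `τ ∈ M` raising the height of representatives by one and reaching every representative (`ht (rep (τ·r)) = ht r + 1`,
every `r′ ∈ R` is `rep (τ·r)`).  Model: `M = C_q(X) = ⊕_{F ∈ X_q} V^{U_F}` a chain module of the Schneider–Stuhler resolution on the Bruhat–Tits tree, the `N`-orbits of `q`-facets
in a `B`-orbit forming the `τ`-string `N τ^n F`.  Then, on the JACQUET MODULE `M_N = (t.restrict ρ).Coinvariants` with its `M`-action `r(·) = ρ.jacquetModule t` (★):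
* (§1) dictionary: the blocks are permuted EXACTLY, `ρ(g) W_b = W_{g·b}`; the data restrict to the subgroup `N` of `P` in ★ FILE 1's currency; the local kernel
  `K_r = span{ρ(s) w − w : s ∈ N, s·r = r, w ∈ W_r}`;
* (§2) **`r(τ) − 1` IS INJECTIVE on `M_N`** (`injective_jacquetModule_sub_id`) — ★ FILE 2b grades `M_N = ⊕_n M_N⁽ⁿ⁾` by height, `r(τ)` shifts the grading, ★ FILE 2a;
* (§3) **`dim M_N ⧸ (r(τ) − 1) M_N = Σ_{r ∈ R, ht r = 0} dim W_r ⧸ K_r`** (`finrank_quotient_range_jacquetModule_sub_id_eq_sum`; finite-dimensional blocks, finitely many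
  representatives of height `0`) — ★ FILE 2a (cokernel = degree-`0` piece) + ★ FILE 2b §5.
Consumer: 47c FILE 4 (the Euler identity `Σ_{R₀¹} dim W_r ⧸ K_r = Σ_{R₀⁰} dim W_r ⧸ K_r` along the ★ Jacquet-exact image `0 → (C₁)_N → (C₀)_N → V_N → 0` of the ★ 41d resolution, with
`V_N` finite-dimensional, via the snake lemma 47a′), then 47d (`tr (i_B χ)(f_EP^{V,e}) = 0`).

## References
* [BernsteinZelevinsky1976] I. N. Bernstein, A. V. Zelevinsky, *Representations of the group GL(n, F) where F is a local non-archimedean field*, Russian Math. Surveys 31 (1976): §2.3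
  (the Jacquet functor `V ↦ V_N`).
* [Casselman1995] W. Casselman, *Introduction to the theory of admissible representations of p-adic reductive groups* (1995 notes): §3.1–§3.2 (Jacquet modules), §6.3 (the
  geometric lemma: Jacquet modules of representations built from `P`-orbits).
* [Brown1982] K. S. Brown, *Cohomology of Groups* (1982): III §5–§6 (induced modules; `H₀` and `H₁` of `ℤ` with coefficients in `k[ℤ] ⊗ W`).
-/

set_option autoImplicit false

open scoped BigOperators DirectSum

namespace Representation

open Literature.NumberTheory.Automorphic

variable {k G M : Type*} [Field k] [Group G] [AddCommGroup M] [Module k M] (t : ParabolicTriple G) {ρ : Representation k G M}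
variable {β : Type*} {Blk : β → Submodule k M} {act : G → β → β}

/-! ## §1 Dictionary: exact block permutation; restriction of the data to `N ≤ P`; the local kernel -/

/-- **THE BLOCKS ARE PERMUTED EXACTLY**: `ρ(g) W_b = W_{g·b}` (the inclusion for `g⁻¹` gives the reverse one). [cite: Casselman1995, §6.3] -/
theorem map_block_eq_block_act (hact : ∀ g g' b, act (g * g') b = act g (act g' b)) (hact1 : ∀ b, act 1 b = b)
    (hperm : ∀ g b m, m ∈ Blk b → ρ g m ∈ Blk (act g b)) (g : G) (b : β) : (Blk b).map (ρ g) = Blk (act g b) := by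
  refine le_antisymm ?_ fun m hm => ?_
  · rintro _ ⟨m, hm, rfl⟩; exact hperm g b m hm
  · refine ⟨ρ g⁻¹ m, apply_inv_mem_block (τ := ρ) hact hact1 hperm hm, ?_⟩
    rw [← Module.End.mul_apply, ← map_mul, mul_inv_cancel, map_one, Module.End.one_apply]

/-- The local kernel in `N ≤ P`-currency equals the local kernel in `G`-currency: `{ρ(s) w − w : s ∈ N (as the subgroup `N ∩ P` of `P`), s·r = r, w ∈ W_r}` =
`{ρ(s) w − w : s ∈ G, s ∈ N, s·r = r, w ∈ W_r}`. [cite: BernsteinZelevinsky1976, §2.3] -/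
theorem localKer_set_restrict_eq (r : β) :
    {x : M | ∃ (s : ↥(t.N.subgroupOf t.P)) (w : M), act ((s : t.P) : G) r = r ∧ w ∈ Blk r ∧ x = t.restrict ρ s w - w} =
      {x : M | ∃ (s : G) (w : M), s ∈ t.N ∧ act s r = r ∧ w ∈ Blk r ∧ x = ρ s w - w} := by
  ext x
  constructor
  · rintro ⟨s, w, hs, hw, rfl⟩
    exact ⟨((s : t.P) : G), w, Subgroup.mem_subgroupOf.1 s.2, hs, hw, rfl⟩
  · rintro ⟨s, w, hsN, hs, hw, rfl⟩
    exact ⟨⟨⟨s, t.N_le hsN⟩, Subgroup.mem_subgroupOf.2 hsN⟩, w, hs, hw, rfl⟩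

section Torus

variable [DecidableEq β] (h : DirectSum.IsInternal Blk) (hact : ∀ g g' b, act (g * g') b = act g (act g' b)) (hact1 : ∀ b, act 1 b = b)
  (hperm : ∀ g b m, m ∈ Blk b → ρ g m ∈ Blk (act g b)) {R : Set β} (rep : β → β) (tr : β → G) (htrN : ∀ b, tr b ∈ t.N) (hrepR : ∀ b, rep b ∈ R)
  (htr : ∀ b, act (tr b) (rep b) = b) (hrep_act : ∀ n ∈ t.N, ∀ b, rep (act n b) = rep b) (hrep_id : ∀ r ∈ R, rep r = r) (ht : β → ℤ) {τ : G} (hτ : τ ∈ t.M)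
  (hsh : ∀ r ∈ R, ht (rep (act τ r)) = ht r + 1) (hsh' : ∀ r' ∈ R, ∃ r ∈ R, rep (act τ r) = r')

include h hact hact1 hperm htrN hrepR htr hrep_act hrep_id hsh hsh' in
/-- **THE HEIGHT GRADING OF THE JACQUET MODULE AND ITS SHIFT** (★ FILE 2b instantiated): `M_N = ⊕_n M_N⁽ⁿ⁾` internally, `M_N⁽ⁿ⁾ = Σ_{r ∈ R, ht r = n} [W_r]`, `r(τ)` is injective and
`r(τ) M_N⁽ⁿ⁾ = M_N⁽ⁿ⁺¹⁾`. [cite: Casselman1995, §6.3] [cite: BernsteinZelevinsky1976, §2.3] -/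
theorem isInternal_heightPiece_jacquet_and_shift :
    DirectSum.IsInternal (fun n : ℤ => ⨆ r ∈ {r | r ∈ R ∧ ht r = n}, (Blk r).map (Coinvariants.mk (t.restrict ρ))) ∧
      Function.Injective (ρ.jacquetModule t ⟨τ, hτ⟩) ∧
      ∀ n : ℤ, (⨆ r ∈ {r | r ∈ R ∧ ht r = n}, (Blk r).map (Coinvariants.mk (t.restrict ρ))).map (ρ.jacquetModule t ⟨τ, hτ⟩ : _ →ₗ[k] _) =
        ⨆ r ∈ {r | r ∈ R ∧ ht r = n + 1}, (Blk r).map (Coinvariants.mk (t.restrict ρ)) := by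
  -- the `N ≤ P` data in ★ FILE 1's currency
  let tr' : β → ↥(t.N.subgroupOf t.P) := fun b => ⟨⟨tr b, t.N_le (htrN b)⟩, Subgroup.mem_subgroupOf.2 (htrN b)⟩
  have hact' : ∀ (n n' : ↥(t.N.subgroupOf t.P)) (b : β), act (((n * n' : ↥(t.N.subgroupOf t.P)) : t.P) : G) b = act ((n : t.P) : G) (act ((n' : t.P) : G) b) :=
    fun n n' b => hact _ _ b
  have hact1' : ∀ b : β, act (((1 : ↥(t.N.subgroupOf t.P)) : t.P) : G) b = b := fun b => hact1 b
  have hperm' : ∀ (n : ↥(t.N.subgroupOf t.P)) (b : β) (m : M), m ∈ Blk b → t.restrict ρ n m ∈ Blk (act ((n : t.P) : G) b) := fun n b m hm => hperm _ b m hm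
  have htr' : ∀ b, act (((tr' b : ↥(t.N.subgroupOf t.P)) : t.P) : G) (rep b) = b := fun b => htr b
  have hrep_act' : ∀ (n : ↥(t.N.subgroupOf t.P)) (b : β), rep (act ((n : t.P) : G) b) = rep b := fun n b => hrep_act _ (Subgroup.mem_subgroupOf.1 n.2) b
  have hW : ∀ n : ℤ, (fun n : ℤ => ⨆ r ∈ {r | r ∈ R ∧ ht r = n}, (Blk r).map (Coinvariants.mk (t.restrict ρ))) n =
      ⨆ r ∈ {r | r ∈ R ∧ ht r = n}, (Blk r).map (Coinvariants.mk (t.restrict ρ)) := fun n => rfl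
  refine ⟨isInternal_heightPiece (τ := t.restrict ρ) (act := fun n b => act ((n : t.P) : G) b) h hact' hact1' hperm' rep tr' hrepR htr' hrep_act' hrep_id ht hW, ?_, fun n => ?_⟩
  · refine Function.LeftInverse.injective (g := ρ.jacquetModule t ⟨τ, hτ⟩⁻¹) fun x => ?_
    rw [← Module.End.mul_apply, ← map_mul, inv_mul_cancel, map_one, Module.End.one_apply]
  · exact map_heightPiece_eq (τ := t.restrict ρ) (act := fun n b => act ((n : t.P) : G) b) hact' hact1' hperm' rep tr' hrepR htr' ht (T := ρ τ)
      (Tbar := (ρ.jacquetModule t ⟨τ, hτ⟩ : _ →ₗ[k] _)) (fun m => jacquetModule_mk ρ t ⟨τ, hτ⟩ m) (sh := act τ)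
      (fun b => map_block_eq_block_act hact hact1 hperm τ b) hsh hsh' hW n

/-! ## §2 `r(τ) − 1` is injective on the Jacquet module -/

include h hact hact1 hperm htrN hrepR htr hrep_act hrep_id hsh hsh' in
/-- **`r(τ) − 1` IS INJECTIVE ON THE JACQUET MODULE OF A BLOCK-PERMUTATION MODULE** (`H₁` of the `τ`-string vanishes: `(C_q)_N` is `τ`-torsion-free as a `k[τ^±]`-module).
[cite: Casselman1995, §6.3] [cite: Brown1982, III §5] -/
theorem injective_jacquetModule_sub_id :
    Function.Injective (ρ.jacquetModule t ⟨τ, hτ⟩ - LinearMap.id : (t.restrict ρ).Coinvariants →ₗ[k] (t.restrict ρ).Coinvariants) := by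
  obtain ⟨hint, hinj, hshift⟩ := isInternal_heightPiece_jacquet_and_shift t h hact hact1 hperm rep tr htrN hrepR htr hrep_act hrep_id ht hτ hsh hsh'
  exact LinearMap.injective_sub_id_of_shift hint hinj fun n x hx => by rw [← hshift n]; exact Submodule.mem_map_of_mem hx

/-! ## §3 The dimension of the cokernel of `r(τ) − 1` -/

include h hact hact1 hperm htrN hrepR htr hrep_act hrep_id hsh hsh' in
/-- **`dim M_N ⧸ (r(τ) − 1) M_N = dim M_N⁽⁰⁾`** (the cokernel of `r(τ) − 1` is the degree-zero piece `Σ_{r ∈ R, ht r = 0} [W_r]`). [cite: Casselman1995, §6.3] [cite: Brown1982, III §5] -/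
theorem finrank_quotient_range_jacquetModule_sub_id_eq :
    Module.finrank k ((t.restrict ρ).Coinvariants ⧸ LinearMap.range (ρ.jacquetModule t ⟨τ, hτ⟩ - LinearMap.id : (t.restrict ρ).Coinvariants →ₗ[k] _)) =
      Module.finrank k ↥(⨆ r ∈ {r | r ∈ R ∧ ht r = 0}, (Blk r).map (Coinvariants.mk (t.restrict ρ))) := by
  obtain ⟨hint, hinj, hshift⟩ := isInternal_heightPiece_jacquet_and_shift t h hact hact1 hperm rep tr htrN hrepR htr hrep_act hrep_id ht hτ hsh hsh'
  exact LinearMap.finrank_quotient_range_sub_id_eq hint hinj hshift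

include h hact hact1 hperm htrN hrepR htr hrep_act hrep_id hsh hsh' in
/-- **`dim M_N ⧸ (r(τ) − 1) M_N = Σ_{r ∈ R, ht r = 0} dim W_r ⧸ K_r`** for finite-dimensional blocks and finitely many representatives `R₀` of height `0`, with the local kernels
`K_r = span{ρ(s) w − w : s ∈ N, s·r = r, w ∈ W_r}` (model: `W_F ⧸ K_F = (V^{U_F})_{N ∩ P_F}`, one `q`-facet `F` per `B`-orbit). [cite: Casselman1995, §6.3] [cite: BernsteinZelevinsky1976, §2.3]
[cite: Brown1982, III §5–§6] -/
theorem finrank_quotient_range_jacquetModule_sub_id_eq_sum (hfd : ∀ b, FiniteDimensional k (Blk b)) (R₀ : Finset β)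
    (hR₀ : ∀ r, r ∈ R₀ ↔ r ∈ R ∧ ht r = 0) :
    Module.finrank k ((t.restrict ρ).Coinvariants ⧸ LinearMap.range (ρ.jacquetModule t ⟨τ, hτ⟩ - LinearMap.id : (t.restrict ρ).Coinvariants →ₗ[k] _)) =
      ∑ r ∈ R₀, Module.finrank k (↥(Blk r) ⧸
        (Submodule.span k {x : M | ∃ (s : G) (w : M), s ∈ t.N ∧ act s r = r ∧ w ∈ Blk r ∧ x = ρ s w - w}).comap (Blk r).subtype) := by
  rw [finrank_quotient_range_jacquetModule_sub_id_eq t h hact hact1 hperm rep tr htrN hrepR htr hrep_act hrep_id ht hτ hsh hsh']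
  let tr' : β → ↥(t.N.subgroupOf t.P) := fun b => ⟨⟨tr b, t.N_le (htrN b)⟩, Subgroup.mem_subgroupOf.2 (htrN b)⟩
  have hact' : ∀ (n n' : ↥(t.N.subgroupOf t.P)) (b : β), act (((n * n' : ↥(t.N.subgroupOf t.P)) : t.P) : G) b = act ((n : t.P) : G) (act ((n' : t.P) : G) b) :=
    fun n n' b => hact _ _ b
  have hact1' : ∀ b : β, act (((1 : ↥(t.N.subgroupOf t.P)) : t.P) : G) b = b := fun b => hact1 b
  have hperm' : ∀ (n : ↥(t.N.subgroupOf t.P)) (b : β) (m : M), m ∈ Blk b → t.restrict ρ n m ∈ Blk (act ((n : t.P) : G) b) := fun n b m hm => hperm _ b m hm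
  have htr' : ∀ b, act (((tr' b : ↥(t.N.subgroupOf t.P)) : t.P) : G) (rep b) = b := fun b => htr b
  have hrep_act' : ∀ (n : ↥(t.N.subgroupOf t.P)) (b : β), rep (act ((n : t.P) : G) b) = rep b := fun n b => hrep_act _ (Subgroup.mem_subgroupOf.1 n.2) b
  have hW : ∀ n : ℤ, (fun n : ℤ => ⨆ r ∈ {r | r ∈ R ∧ ht r = n}, (Blk r).map (Coinvariants.mk (t.restrict ρ))) n =
      ⨆ r ∈ {r | r ∈ R ∧ ht r = n}, (Blk r).map (Coinvariants.mk (t.restrict ρ)) := fun n => rfl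
  rw [← hW 0, finrank_heightPiece_zero_eq_sum (τ := t.restrict ρ) (act := fun n b => act ((n : t.P) : G) b) h hact' hact1' hperm' rep tr' htr' hrep_act' hrep_id hfd ht hW R₀ hR₀]
  refine Finset.sum_congr rfl fun r _ => ?_
  rw [localKer_set_restrict_eq t r]

end Torus

end Representation
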